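import Summits.Ventures.CertifiedManyBodySolver.Downfold.EmeryShapeTrueCornerRule
import Summits.Ventures.CertifiedManyBodySolver.Downfold.EmeryFermiScalePointsHg1201DFTTrueCornersNH1125
import Summits.Ventures.CertifiedManyBodySolver.Downfold.EmeryFermiScalePointsHg1201DFTTrueCornersNH116
import HarnessLib

/-!
# THE ONE-BAND FERMI-SURFACE SHAPE `t′/t` OF THE WHOLE TYPED 3BE BOX `emeryBoxHg1201 ∩ {Δ_pd ∈ [1.4, 1.93]} (DFT-level Δ tag)` AT ITS TWO TRUE CORNERS (true-corner rule under certified margins, §B.87 (i),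
# read on a Δ_pd LEVEL-TAG SUB-BOX of box #19: INFL-3to1-B §B.89 «object E by Δ-level tag»; router/EMERY-OBJECT-E-BYTAG.tsv)

Venture CertifiedManyBodySolver, cell `pub/hubbard-downfold` (stage S1; INFLATION-RULES-3to1-B §B.87 (i) device, §B.89 reading), seat hubbard-downfold-mod-4 (technique B, g35 generator, g37 run); namespace
`Summit.Ventures.CertifiedManyBodySolver.Downfold.Emery`. Everything PROVED (0 sorry). WHAT THIS IS NOT: a statement about HgBa₂CuO₄ box #19 (P = 0) — DFT-LEVEL Δ_pd members [1.4, 1.93] (level tag, HgBa2CuO4.md l.171) — the typed box is SCREENING-GRADE; `U = 0`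
one-body kinematics of the σ model; object E = the EXACT `t–t′` shape of the σ Fermi surface at the row's own Fermi energy.

For EVERY one-body row of `[1.4, 1.93] × [1.12, 1.32] × [0.64, 0.85] × [0.161, 0.208]` eV the one-band `t′/t` lies between its values at the TRUE corners `(Δ₁, a₁, b₂, c₂)` and `(Δ₂, a₂, b₁, c₁)`
(`EmeryShapeTrueCornerRule`; the t_pp / t_pp′ directions by the MARGIN LEVERS of `EmeryMarginLevers`, margins certified by `norm_num` with the constants `M` printed below), read
over their K = 384 brackets (`EmeryFermiScalePointsHg1201DFTTrueCornersNH1125/NH116`).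

| filling | **true-corner window (certified)** | margins (t_pp lower/upper; t_pp′ lower/upper) | WHOLE box #19 true-corner window (g35, `EmeryBoxesHg1201TrueCorners`) | g19 sub-box device |
|---|---|---|---|---|
| n_H = 1.125 (ν = 7/16) | **[-0.3654, -0.2813]** | M_b 0.0167 / 2.3307; M_c 0.8932 / 0.1874 | [-0.3654, -0.2640] | [-0.3717,-0.2486] (whole box, n_H band) |
| n_H = 1.16 (ν = 21/50) | **[-0.3651, -0.2816]** | M_b 0.0611 / 2.3682; M_c 0.8223 / 0.1182 | [-0.3651, -0.2641] | [-0.3717,-0.2486] (whole box, n_H band) |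

Sources: three-band model [HybertsenSchluterChristensen1989, Eq. (1)]; [AndersenEtAl1995, §6]; box rows as cited in the typed object's file.
-/

noncomputable section

namespace Summit.Ventures.CertifiedManyBodySolver.Downfold.Emery

open Real Set

/-- **n_H = 1.125 (ν = 7/16): for every row of the box the one-band Fermi-surface `t′/t` (object E) lies in `[-0.3654, -0.2813]` — its values at the two TRUE corners** (margin levers; margins by `norm_num`). [folklore] -/
theorem hg1201DFTBox_fsRatio_true_nH1125 {Δ a b c : ℝ} (hΔ : Δ ∈ Icc ((7 : ℝ) / 5) ((193 : ℝ) / 100)) (ha : a ∈ Icc ((28 : ℝ) / 25) ((33 : ℝ) / 25)) (hb : b ∈ Icc ((16 : ℝ) / 25) ((17 : ℝ) / 20)) (hc : c ∈ Icc ((161 : ℝ) / 1000) ((26 : ℝ) / 125)) :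
    fsRatio Δ a b c (fermiEnergyOf Δ a b c ((7 : ℝ) / 16)) ∈ Icc ((-1827 : ℝ) / 5000) ((-2813 : ℝ) / 10000) := by
  have hSL := (fermiEnergyOf_of_pointBracketCheck truePt_Hg1201DFTSL_nH1125_br (by norm_num) (by norm_num) (by norm_num) (ν := (7/16 : ℝ)) (by push_cast; exact ⟨le_rfl, le_rfl⟩)).2
  have hTL := (fermiEnergyOf_of_pointBracketCheck truePt_Hg1201DFTTL_nH1125_br (by norm_num) (by norm_num) (by norm_num) (ν := (7/16 : ℝ)) (by push_cast; exact ⟨le_rfl, le_rfl⟩)).2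
  have hSU := (fermiEnergyOf_of_pointBracketCheck truePt_Hg1201DFTSU_nH1125_br (by norm_num) (by norm_num) (by norm_num) (ν := (7/16 : ℝ)) (by push_cast; exact ⟨le_rfl, le_rfl⟩)).2
  have hQU := (fermiEnergyOf_of_pointBracketCheck truePt_Hg1201DFTQU_nH1125_br (by norm_num) (by norm_num) (by norm_num) (ν := (7/16 : ℝ)) (by push_cast; exact ⟨le_rfl, le_rfl⟩)).2
  have hTH := (fermiEnergyOf_of_pointBracketCheck truePt_Hg1201DFTTH_nH1125_br (by norm_num) (by norm_num) (by norm_num) (ν := (7/16 : ℝ)) (by push_cast; exact ⟨le_rfl, le_rfl⟩)).2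
  have hAlo := (fermiEnergyOf_of_pointBracketCheck truePt_Hg1201DFTAL_nH1125_br (by norm_num) (by norm_num) (by norm_num) (ν := (7/16 : ℝ)) (by push_cast; exact ⟨le_rfl, le_rfl⟩)).2
  have hTop := (fermiEnergyOf_of_pointBracketCheck truePt_Hg1201DFTHH_nH1125_br (by norm_num) (by norm_num) (by norm_num) (ν := (7/16 : ℝ)) (by push_cast; exact ⟨le_rfl, le_rfl⟩)).2
  push_cast at hSL hTL hSU hQU hTH hAlo hTop
  norm_num at hSL hTL hSU hQU hTH hAlo hTop
  obtain ⟨hΔl, hΔu⟩ := hΔ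
  obtain ⟨hal, hau⟩ := ha
  constructor
  · have hlow := fsRatio_fermiEnergyOf_trueCorner_lower (Δ₁ := ((7 : ℝ) / 5)) (a₁ := ((28 : ℝ) / 25)) (b₁ := ((16 : ℝ) / 25)) (b₂ := ((17 : ℝ) / 20)) (c₁ := ((161 : ℝ) / 1000)) (c₂ := ((26 : ℝ) / 125))
      (ν := ((7 : ℝ) / 16)) (pL := ((15441 : ℝ) / 10000)) (qL := ((841 : ℝ) / 500)) (Mb := ((167 : ℝ) / 10000)) (Mc := ((2233 : ℝ) / 2500)) (by norm_num) hΔl (by norm_num) hal (by norm_num) hb (by norm_num) hc (by norm_num) (by norm_num) (by norm_num)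
      (by norm_num) hSL.1 hAlo.2 (by norm_num) (by norm_num [fsD, fsN]) (by norm_num) (by norm_num) (by norm_num [fsD, fsN]) (by norm_num) (by norm_num [dopingDisc]) (by norm_num [fsD, fsN])
    refine le_trans ?_ hlow
    have hw := (fsRatio_mem_Icc_on_window_of_dopingDisc_nonneg (Δ := ((7 : ℝ) / 5)) (a := ((28 : ℝ) / 25)) (b := ((17 : ℝ) / 20)) (c := ((26 : ℝ) / 125))
      (p := ((16249 : ℝ) / 10000)) (q := ((16399 : ℝ) / 10000)) (by norm_num) (by norm_num) (by norm_num) (by norm_num) (by norm_num) (by norm_num) (by norm_num) (by norm_num [dopingDisc]) hTL).1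
    refine le_trans ?_ hw
    norm_num [fsRatio, fsD, fsN]
  · have hup := fsRatio_fermiEnergyOf_trueCorner_upper (Δ₁ := ((7 : ℝ) / 5)) (Δ₂ := ((193 : ℝ) / 100)) (a₁ := ((28 : ℝ) / 25)) (a₂ := ((33 : ℝ) / 25)) (b₁ := ((16 : ℝ) / 25)) (b₂ := ((17 : ℝ) / 20)) (c₁ := ((161 : ℝ) / 1000)) (c₂ := ((26 : ℝ) / 125))
      (ν := ((7 : ℝ) / 16)) (pU := ((17159 : ℝ) / 10000)) (qU := ((18417 : ℝ) / 10000)) (qT := ((511 : ℝ) / 250)) (Mb := ((23307 : ℝ) / 10000)) (Mc := ((937 : ℝ) / 5000)) (by norm_num) ⟨hΔl, hΔu⟩ (by norm_num) ⟨hal, hau⟩ (by norm_num) hb (by norm_num) hc (by norm_num) (by norm_num) (by norm_num)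
      hTop.2 (by norm_num) (by norm_num) hSU.1 hQU.2 (by norm_num) (by norm_num [fsD, fsN]) (by norm_num) (by norm_num) (by norm_num [fsD, fsN]) (by norm_num) (by norm_num) (by norm_num [fsD, fsN])
    refine le_trans hup ?_
    have hw := (fsRatio_mem_Icc_on_window_of_dopingDisc_nonpos (Δ := ((193 : ℝ) / 100)) (a := ((33 : ℝ) / 25)) (b := ((16 : ℝ) / 25)) (c := ((161 : ℝ) / 1000))
      (p := ((8781 : ℝ) / 5000)) (q := ((1107 : ℝ) / 625)) (by norm_num) (by norm_num) (by norm_num) (by norm_num) (by norm_num) (by norm_num) (by norm_num) (by norm_num [dopingDisc]) hTH).2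
    refine le_trans hw ?_
    norm_num [fsRatio, fsD, fsN]

/-- **n_H = 1.16 (ν = 21/50): for every row of the box the one-band Fermi-surface `t′/t` (object E) lies in `[-0.3651, -0.2816]` — its values at the two TRUE corners** (margin levers; margins by `norm_num`). [folklore] -/
theorem hg1201DFTBox_fsRatio_true_nH116 {Δ a b c : ℝ} (hΔ : Δ ∈ Icc ((7 : ℝ) / 5) ((193 : ℝ) / 100)) (ha : a ∈ Icc ((28 : ℝ) / 25) ((33 : ℝ) / 25)) (hb : b ∈ Icc ((16 : ℝ) / 25) ((17 : ℝ) / 20)) (hc : c ∈ Icc ((161 : ℝ) / 1000) ((26 : ℝ) / 125)) :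
    fsRatio Δ a b c (fermiEnergyOf Δ a b c ((21 : ℝ) / 50)) ∈ Icc ((-3651 : ℝ) / 10000) ((-176 : ℝ) / 625) := by
  have hSL := (fermiEnergyOf_of_pointBracketCheck truePt_Hg1201DFTSL_nH116_br (by norm_num) (by norm_num) (by norm_num) (ν := (21/50 : ℝ)) (by push_cast; exact ⟨le_rfl, le_rfl⟩)).2
  have hTL := (fermiEnergyOf_of_pointBracketCheck truePt_Hg1201DFTTL_nH116_br (by norm_num) (by norm_num) (by norm_num) (ν := (21/50 : ℝ)) (by push_cast; exact ⟨le_rfl, le_rfl⟩)).2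
  have hSU := (fermiEnergyOf_of_pointBracketCheck truePt_Hg1201DFTSU_nH116_br (by norm_num) (by norm_num) (by norm_num) (ν := (21/50 : ℝ)) (by push_cast; exact ⟨le_rfl, le_rfl⟩)).2
  have hQU := (fermiEnergyOf_of_pointBracketCheck truePt_Hg1201DFTQU_nH116_br (by norm_num) (by norm_num) (by norm_num) (ν := (21/50 : ℝ)) (by push_cast; exact ⟨le_rfl, le_rfl⟩)).2
  have hTH := (fermiEnergyOf_of_pointBracketCheck truePt_Hg1201DFTTH_nH116_br (by norm_num) (by norm_num) (by norm_num) (ν := (21/50 : ℝ)) (by push_cast; exact ⟨le_rfl, le_rfl⟩)).2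
  have hAlo := (fermiEnergyOf_of_pointBracketCheck truePt_Hg1201DFTAL_nH116_br (by norm_num) (by norm_num) (by norm_num) (ν := (21/50 : ℝ)) (by push_cast; exact ⟨le_rfl, le_rfl⟩)).2
  have hTop := (fermiEnergyOf_of_pointBracketCheck truePt_Hg1201DFTHH_nH116_br (by norm_num) (by norm_num) (by norm_num) (ν := (21/50 : ℝ)) (by push_cast; exact ⟨le_rfl, le_rfl⟩)).2
  push_cast at hSL hTL hSU hQU hTH hAlo hTop
  norm_num at hSL hTL hSU hQU hTH hAlo hTop
  obtain ⟨hΔl, hΔu⟩ := hΔ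
  obtain ⟨hal, hau⟩ := ha
  constructor
  · have hlow := fsRatio_fermiEnergyOf_trueCorner_lower (Δ₁ := ((7 : ℝ) / 5)) (a₁ := ((28 : ℝ) / 25)) (b₁ := ((16 : ℝ) / 25)) (b₂ := ((17 : ℝ) / 20)) (c₁ := ((161 : ℝ) / 1000)) (c₂ := ((26 : ℝ) / 125))
      (ν := ((21 : ℝ) / 50)) (pL := ((3011 : ℝ) / 2000)) (qL := ((16369 : ℝ) / 10000)) (Mb := ((611 : ℝ) / 10000)) (Mc := ((8223 : ℝ) / 10000)) (by norm_num) hΔl (by norm_num) hal (by norm_num) hb (by norm_num) hc (by norm_num) (by norm_num) (by norm_num)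
      (by norm_num) hSL.1 hAlo.2 (by norm_num) (by norm_num [fsD, fsN]) (by norm_num) (by norm_num) (by norm_num [fsD, fsN]) (by norm_num) (by norm_num [dopingDisc]) (by norm_num [fsD, fsN])
    refine le_trans ?_ hlow
    have hw := (fsRatio_mem_Icc_on_window_of_dopingDisc_nonneg (Δ := ((7 : ℝ) / 5)) (a := ((28 : ℝ) / 25)) (b := ((17 : ℝ) / 20)) (c := ((26 : ℝ) / 125))
      (p := ((15797 : ℝ) / 10000)) (q := ((15947 : ℝ) / 10000)) (by norm_num) (by norm_num) (by norm_num) (by norm_num) (by norm_num) (by norm_num) (by norm_num) (by norm_num [dopingDisc]) hTL).1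
    refine le_trans ?_ hw
    norm_num [fsRatio, fsD, fsN]
  · have hup := fsRatio_fermiEnergyOf_trueCorner_upper (Δ₁ := ((7 : ℝ) / 5)) (Δ₂ := ((193 : ℝ) / 100)) (a₁ := ((28 : ℝ) / 25)) (a₂ := ((33 : ℝ) / 25)) (b₁ := ((16 : ℝ) / 25)) (b₂ := ((17 : ℝ) / 20)) (c₁ := ((161 : ℝ) / 1000)) (c₂ := ((26 : ℝ) / 125))
      (ν := ((21 : ℝ) / 50)) (pU := ((16817 : ℝ) / 10000)) (qU := ((17967 : ℝ) / 10000)) (qT := ((19951 : ℝ) / 10000)) (Mb := ((11841 : ℝ) / 5000)) (Mc := ((591 : ℝ) / 5000)) (by norm_num) ⟨hΔl, hΔu⟩ (by norm_num) ⟨hal, hau⟩ (by norm_num) hb (by norm_num) hc (by norm_num) (by norm_num) (by norm_num)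
      hTop.2 (by norm_num) (by norm_num) hSU.1 hQU.2 (by norm_num) (by norm_num [fsD, fsN]) (by norm_num) (by norm_num) (by norm_num [fsD, fsN]) (by norm_num) (by norm_num) (by norm_num [fsD, fsN])
    refine le_trans hup ?_
    have hw := (fsRatio_mem_Icc_on_window_of_dopingDisc_nonpos (Δ := ((193 : ℝ) / 100)) (a := ((33 : ℝ) / 25)) (b := ((16 : ℝ) / 25)) (c := ((161 : ℝ) / 1000))
      (p := ((2153 : ℝ) / 1250)) (q := ((4331 : ℝ) / 2500)) (by norm_num) (by norm_num) (by norm_num) (by norm_num) (by norm_num) (by norm_num) (by norm_num) (by norm_num [dopingDisc]) hTH).2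
    refine le_trans hw ?_
    norm_num [fsRatio, fsD, fsN]

end Summit.Ventures.CertifiedManyBodySolver.Downfold.Emery
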